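import Mathlib
import Summits.ResolutionOfSingularities.ResolutionOfSingularities.Theorems.WildQuotientsWildQuotientResolutionJordanFiveMu2CoverDefs

/-!
# R-T rung, `J₅`, `μ₂`-vertex: the lifted action and the deck involution on the cover coordinate ring `k[s, Y₀,…,Y₄, passengers]`

(crux stmt-ResolutionOfSingularities-15640 `WildQuotients.WildQuotientResolution`, line `Sketch`,
sector `|G| = p`; RUNG V5 of `L/w45c/CHAIN.md` v8.1, brick B7/`HP₂` step (α) part 2b
(res-L1-w45c-plan-1 RULING 2026-08-27T11:12Z; design res-L1-w45c-idea-2 `W2-DESIGN.md` §6 =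
res-type-036 PROPOSAL 2026-08-27T11:25:02Z, kit j277185); twin of res-L1-w45c-stub-1's
`…JordanFourRootChart0Action` / res-L1-w45c-stub-4's `…JordanFourOrder`. [OURS · L1 W4.5c] — NOT a
statement of any manuscript; replaces the role of no printed item. Prover res-type-036. Def-free.)

The AMBIENT coordinate ring of the twisted-root cover of `W₂` is `A = k[s, Y₀, Y₁, Y₂, Y₃, Y₄, pass]`,
modelled as `MvPolynomial (Option (Fin n)) k` with `s = X none` and `Yᵢ = X (some ·)` on the slots
`a, b, c, d, e` of the `J₅` datum (passengers `X (some j)`, `j ∉ {a,…,e}`). The LIFTED ACTION `σ_U`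
is given ABSTRACTLY by its law `s ↦ s`, `Y₀ ↦ Y₀`, `Y₁ ↦ Y₁ + sY₀`, `Y₂ ↦ Y₂ + sY₁`,
`Y₃ ↦ Y₃ + sY₂`, `Y₄ ↦ Y₄ + sY₃`, passengers fixed; the DECK INVOLUTION `τ` by
`s, Y₁, Y₃ ↦ −s, −Y₁, −Y₃`, everything else fixed.

* iterates `cover_pow_apply_*` (`σ_Uᵐ Y_j = Σᵢ C(m,i) sⁱ Y_{j−i}`), **`cover_pow_prime_eq_one`**
  (`σ_U ^ p = 1` for `p ≥ 5`: `p ∣ C(p,i)`, `1 ≤ i ≤ 4`), `cover_ne_one`, `cover_card_zpowers_prime`;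
* (existence of such automorphisms: `…Mu2CoverActionExists`);
* `cover_apply_coverPhi` / `cover_apply_coverIHat` / `coverTau_apply_coverPhi` /
  `coverTau_apply_coverIHat` — `σ_U` and `τ` fix `Φ` and `î` (`…Mu2CoverDefs`), so both descend to
  `U₂ = (A ⧸ (Φ))[1/î]`;
* `cover_comm_coverTau` — `σ_U ∘ τ = τ ∘ σ_U`.
-/

-- single-problem summit: the doubled namespace component `ResolutionOfSingularities` is forced
set_option linter.dupNamespace false

noncomputable section

open MvPolynomial

namespace Summit.ResolutionOfSingularities.ResolutionOfSingularities.Theorems.WildQuotientResolution.JordanFive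

variable (k : Type) [Field k] (n : ℕ)
  (σU : MvPolynomial (Option (Fin n)) k ≃ₐ[k] MvPolynomial (Option (Fin n)) k)
  (a b c d e : Fin n) (hab : a ≠ b) (hac : a ≠ c) (had : a ≠ d) (hae : a ≠ e)
  (hs : σU (X none) = X none)
  (h1 : σU (X (some b)) = X (some b) + X none * X (some a))
  (h2 : σU (X (some c)) = X (some c) + X none * X (some b))
  (h3 : σU (X (some d)) = X (some d) + X none * X (some c))
  (h4 : σU (X (some e)) = X (some e) + X none * X (some d))
  (hσ : ∀ i, i ≠ b → i ≠ c → i ≠ d → i ≠ e → σU (X (some i)) = X (some i))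

/-! ## Iterates and order -/

include hσ in
/-- `σ_Uᵐ` fixes the passenger coordinates `Y_i`, `i ∉ {b,c,d,e}` (in particular `Y₀ = X (some a)`).
[folklore] -/
theorem cover_pow_apply_X_of_ne (m : ℕ) (i : Fin n) (hib : i ≠ b) (hic : i ≠ c) (hid : i ≠ d)
    (hie : i ≠ e) : (σU ^ m) (X (some i)) = X (some i) := by
  induction m with
  | zero => simp
  | succ m ih => rw [pow_succ', AlgEquiv.mul_apply, ih, hσ i hib hic hid hie]

include hs in
/-- `σ_Uᵐ s = s`. [folklore] -/
theorem cover_pow_apply_s (m : ℕ) : (σU ^ m) (X none) = X none := by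
  induction m with
  | zero => simp
  | succ m ih => rw [pow_succ', AlgEquiv.mul_apply, ih, hs]

include hab hac had hae hs h1 hσ in
/-- `σ_Uᵐ Y₁ = Y₁ + m·sY₀`. [folklore] -/
theorem cover_pow_apply_X_b (m : ℕ) :
    (σU ^ m) (X (some b)) = X (some b) +
      (m : MvPolynomial (Option (Fin n)) k) * (X none * X (some a)) := by
  induction m with
  | zero => simp
  | succ m ih =>
    rw [pow_succ', AlgEquiv.mul_apply, ih, map_add, map_mul, map_mul, map_natCast, h1, hs,
      hσ a hab hac had hae]
    push_cast
    ring

include hab hac had hae hs h1 h2 hσ in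
/-- `σ_Uᵐ Y₂ = Y₂ + m·sY₁ + C(m,2)·s²Y₀`. [folklore] -/
theorem cover_pow_apply_X_c (m : ℕ) :
    (σU ^ m) (X (some c)) = X (some c) +
      (m : MvPolynomial (Option (Fin n)) k) * (X none * X (some b)) +
      ((m.choose 2 : ℕ) : MvPolynomial (Option (Fin n)) k) * (X none ^ 2 * X (some a)) := by
  induction m with
  | zero => simp
  | succ m ih =>
    rw [pow_succ', AlgEquiv.mul_apply, ih, map_add, map_add, map_mul, map_mul, map_mul, map_mul,
      map_pow, map_natCast, map_natCast, h2, h1, hs, hσ a hab hac had hae,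
      Nat.choose_succ_succ' m 1, Nat.choose_one_right]
    push_cast
    ring

include hab hac had hae hs h1 h2 h3 hσ in
/-- `σ_Uᵐ Y₃ = Y₃ + m·sY₂ + C(m,2)·s²Y₁ + C(m,3)·s³Y₀`. [folklore] -/
theorem cover_pow_apply_X_d (m : ℕ) :
    (σU ^ m) (X (some d)) = X (some d) +
      (m : MvPolynomial (Option (Fin n)) k) * (X none * X (some c)) +
      ((m.choose 2 : ℕ) : MvPolynomial (Option (Fin n)) k) * (X none ^ 2 * X (some b)) +
      ((m.choose 3 : ℕ) : MvPolynomial (Option (Fin n)) k) * (X none ^ 3 * X (some a)) := by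
  induction m with
  | zero => simp
  | succ m ih =>
    rw [pow_succ', AlgEquiv.mul_apply, ih, map_add, map_add, map_add, map_mul, map_mul, map_mul,
      map_mul, map_mul, map_mul, map_pow, map_pow, map_natCast, map_natCast, map_natCast, h3, h2,
      h1, hs, hσ a hab hac had hae, Nat.choose_succ_succ' m 2, Nat.choose_succ_succ' m 1,
      Nat.choose_one_right]
    push_cast
    ring

include hab hac had hae hs h1 h2 h3 h4 hσ in
/-- `σ_Uᵐ Y₄ = Y₄ + m·sY₃ + C(m,2)·s²Y₂ + C(m,3)·s³Y₁ + C(m,4)·s⁴Y₀`. [folklore] -/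
theorem cover_pow_apply_X_e (m : ℕ) :
    (σU ^ m) (X (some e)) = X (some e) +
      (m : MvPolynomial (Option (Fin n)) k) * (X none * X (some d)) +
      ((m.choose 2 : ℕ) : MvPolynomial (Option (Fin n)) k) * (X none ^ 2 * X (some c)) +
      ((m.choose 3 : ℕ) : MvPolynomial (Option (Fin n)) k) * (X none ^ 3 * X (some b)) +
      ((m.choose 4 : ℕ) : MvPolynomial (Option (Fin n)) k) * (X none ^ 4 * X (some a)) := by
  induction m with
  | zero => simp
  | succ m ih =>
    rw [pow_succ', AlgEquiv.mul_apply, ih, map_add, map_add, map_add, map_add, map_mul, map_mul,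
      map_mul, map_mul, map_mul, map_mul, map_mul, map_mul, map_pow, map_pow, map_pow,
      map_natCast, map_natCast, map_natCast, map_natCast, h4, h3, h2, h1, hs, hσ a hab hac had hae,
      Nat.choose_succ_succ' m 3, Nat.choose_succ_succ' m 2, Nat.choose_succ_succ' m 1,
      Nat.choose_one_right]
    push_cast
    ring

include hab hac had hae hs h1 h2 h3 h4 hσ in
/-- **`σ_U ^ p = 1`** for the cover action in characteristic `p ≥ 5` (`p ∣ C(p,i)` for
`1 ≤ i ≤ 4 < p`). [OURS · L1 W4.5c] -/
theorem cover_pow_prime_eq_one (p : ℕ) (hp : p.Prime) (hp5 : 5 ≤ p) [CharP k p] :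
    σU ^ p = 1 := by
  classical
  have hp0 : ((p : ℕ) : MvPolynomial (Option (Fin n)) k) = 0 := CharP.cast_eq_zero _ p
  have hpc : ∀ i, 0 < i → i < p →
      (((p : ℕ).choose i : ℕ) : MvPolynomial (Option (Fin n)) k) = 0 := fun i hi hip =>
    (CharP.cast_eq_zero_iff (MvPolynomial (Option (Fin n)) k) p _).2
      (hp.dvd_choose_self (Nat.pos_iff_ne_zero.mp hi) hip)
  have hp2 := hpc 2 (by norm_num) (by omega)
  have hp3 := hpc 3 (by norm_num) (by omega)
  have hp4 := hpc 4 (by norm_num) (by omega)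
  have key : ((σU ^ p : MvPolynomial (Option (Fin n)) k ≃ₐ[k] MvPolynomial (Option (Fin n)) k) :
      MvPolynomial (Option (Fin n)) k →ₐ[k] MvPolynomial (Option (Fin n)) k) = AlgHom.id k _ := by
    refine MvPolynomial.algHom_ext fun o => ?_
    change (σU ^ p) (X o) = X o
    rcases o with _ | i
    · exact cover_pow_apply_s k n σU hs p
    by_cases hib : i = b
    · subst hib
      rw [cover_pow_apply_X_b k n σU a i c d e hab hac had hae hs h1 hσ p, hp0, zero_mul, add_zero]
    by_cases hic : i = c
    · subst hic
      rw [cover_pow_apply_X_c k n σU a b i d e hab hac had hae hs h1 h2 hσ p, hp0, hp2, zero_mul,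
        zero_mul, add_zero, add_zero]
    by_cases hid : i = d
    · subst hid
      rw [cover_pow_apply_X_d k n σU a b c i e hab hac had hae hs h1 h2 h3 hσ p, hp0, hp2, hp3,
        zero_mul, zero_mul, zero_mul, add_zero, add_zero, add_zero]
    by_cases hie : i = e
    · subst hie
      rw [cover_pow_apply_X_e k n σU a b c d i hab hac had hae hs h1 h2 h3 h4 hσ p, hp0, hp2, hp3,
        hp4, zero_mul, zero_mul, zero_mul, zero_mul, add_zero, add_zero, add_zero, add_zero]
    · exact cover_pow_apply_X_of_ne k n σU b c d e hσ p i hib hic hid hie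
  apply AlgEquiv.ext
  intro r
  have := DFunLike.congr_fun key r
  simpa using this

include h1 in
/-- **`σ_U ≠ 1`** (`σ_U Y₁ = Y₁ + sY₀ ≠ Y₁`). [folklore] -/
theorem cover_ne_one : σU ≠ 1 := by
  intro h
  have h1' := h1
  rw [h, AlgEquiv.one_apply] at h1'
  have hX : (X none * X (some a) : MvPolynomial (Option (Fin n)) k) = 0 := by
    have := congrArg (fun g => g - X (some b)) h1'
    simp only [sub_self, add_sub_cancel_left] at this
    exact this.symm
  exact mul_ne_zero (MvPolynomial.X_ne_zero _) (MvPolynomial.X_ne_zero _) hX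

include hab hac had hae hs h1 h2 h3 h4 hσ in
/-- **`|⟨σ_U⟩| = p`** for the cover action in characteristic `p ≥ 5`. [folklore] -/
theorem cover_card_zpowers_prime (p : ℕ) (hp : p.Prime) (hp5 : 5 ≤ p) [CharP k p] :
    Nat.card (Subgroup.zpowers σU) = p := by
  haveI : Fact p.Prime := ⟨hp⟩
  rw [Nat.card_zpowers, orderOf_eq_prime
    (cover_pow_prime_eq_one k n σU a b c d e hab hac had hae hs h1 h2 h3 h4 hσ p hp hp5)
    (cover_ne_one k n σU a b h1)]

/-! ## `σ_U` and `τ` fix the cover equation and `î` -/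

include hab hac had hae hs h1 h2 h3 h4 hσ in
/-- **`σ_U Φ = Φ`** for the cover equation `Φ = coverPhi s Y₀ Y₁ Y₂ Y₃ Y₄`. [OURS · L1 W4.5c] -/
theorem cover_apply_coverPhi :
    σU (coverPhi (X none) (X (some a)) (X (some b)) (X (some c)) (X (some d)) (X (some e))) =
      coverPhi (X none) (X (some a)) (X (some b)) (X (some c)) (X (some d))
        (X (some e) : MvPolynomial (Option (Fin n)) k) := by
  have h := map_coverPhi (X none) (X (some a)) (X (some b)) (X (some c)) (X (some d)) (X (some e))
    (σU : MvPolynomial (Option (Fin n)) k →+* MvPolynomial (Option (Fin n)) k)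
  simp only [RingHom.coe_coe] at h
  rw [h, hs, hσ a hab hac had hae, h1, h2, h3, h4, coverPhi_sigma]

include hab hac had hae hs h1 h2 h3 h4 hσ in
/-- **`σ_U î = î`**. [OURS · L1 W4.5c] -/
theorem cover_apply_coverIHat :
    σU (coverIHat (X none) (X (some a)) (X (some b)) (X (some c)) (X (some d)) (X (some e))) =
      coverIHat (X none) (X (some a)) (X (some b)) (X (some c)) (X (some d))
        (X (some e) : MvPolynomial (Option (Fin n)) k) := by
  have h := map_coverIHat (X none) (X (some a)) (X (some b)) (X (some c)) (X (some d)) (X (some e))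
    (σU : MvPolynomial (Option (Fin n)) k →+* MvPolynomial (Option (Fin n)) k)
  simp only [RingHom.coe_coe] at h
  rw [h, hs, hσ a hab hac had hae, h1, h2, h3, h4, coverIHat_sigma]

variable (τ : MvPolynomial (Option (Fin n)) k ≃ₐ[k] MvPolynomial (Option (Fin n)) k)
  (τs : τ (X none) = -X none) (τ1 : τ (X (some b)) = -X (some b))
  (τ3 : τ (X (some d)) = -X (some d))
  (hτ : ∀ i, i ≠ b → i ≠ d → τ (X (some i)) = X (some i))

include hab had τs τ1 τ3 hτ in
/-- **`τ Φ = Φ`**. [OURS · L1 W4.5c] -/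
theorem coverTau_apply_coverPhi (hbc : b ≠ c) (hcd : c ≠ d) (hbe : b ≠ e) (hde : d ≠ e) :
    τ (coverPhi (X none) (X (some a)) (X (some b)) (X (some c)) (X (some d)) (X (some e))) =
      coverPhi (X none) (X (some a)) (X (some b)) (X (some c)) (X (some d))
        (X (some e) : MvPolynomial (Option (Fin n)) k) := by
  have h := map_coverPhi (X none) (X (some a)) (X (some b)) (X (some c)) (X (some d)) (X (some e))
    (τ : MvPolynomial (Option (Fin n)) k →+* MvPolynomial (Option (Fin n)) k)
  simp only [RingHom.coe_coe] at h
  rw [h, τs, hτ a hab had, τ1, hτ c (Ne.symm hbc) hcd, τ3, hτ e (Ne.symm hbe) (Ne.symm hde),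
    coverPhi_tau]

include hab had τs τ1 τ3 hτ in
/-- **`τ î = î`**. [OURS · L1 W4.5c] -/
theorem coverTau_apply_coverIHat (hbc : b ≠ c) (hcd : c ≠ d) (hbe : b ≠ e) (hde : d ≠ e) :
    τ (coverIHat (X none) (X (some a)) (X (some b)) (X (some c)) (X (some d)) (X (some e))) =
      coverIHat (X none) (X (some a)) (X (some b)) (X (some c)) (X (some d))
        (X (some e) : MvPolynomial (Option (Fin n)) k) := by
  have h := map_coverIHat (X none) (X (some a)) (X (some b)) (X (some c)) (X (some d)) (X (some e))
    (τ : MvPolynomial (Option (Fin n)) k →+* MvPolynomial (Option (Fin n)) k)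
  simp only [RingHom.coe_coe] at h
  rw [h, τs, hτ a hab had, τ1, hτ c (Ne.symm hbc) hcd, τ3, hτ e (Ne.symm hbe) (Ne.symm hde),
    coverIHat_tau]

include hab hac had hae hs h1 h2 h3 h4 hσ τs τ1 τ3 hτ in
/-- **`σ_U ∘ τ = τ ∘ σ_U`** (checked on the generators; both fix the passengers).
[OURS · L1 W4.5c; kit j277185] -/
theorem cover_comm_coverTau (hbc : b ≠ c) (hcd : c ≠ d) (hbe : b ≠ e) (hde : d ≠ e)
    (y : MvPolynomial (Option (Fin n)) k) : σU (τ y) = τ (σU y) := by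
  have key : (τ.trans σU : MvPolynomial (Option (Fin n)) k →ₐ[k] MvPolynomial (Option (Fin n)) k) =
      (σU.trans τ : MvPolynomial (Option (Fin n)) k →ₐ[k] MvPolynomial (Option (Fin n)) k) := by
    refine MvPolynomial.algHom_ext fun o => ?_
    change σU (τ (X o)) = τ (σU (X o))
    rcases o with _ | i
    · rw [τs, map_neg, hs, τs]
    by_cases hib : i = b
    · subst hib
      rw [τ1, map_neg, h1, map_add, map_mul, τ1, τs, hτ a hab had]; ring
    by_cases hic : i = c
    · subst hic
      rw [hτ i (Ne.symm hbc) hcd, h2, map_add, map_mul, hτ i (Ne.symm hbc) hcd, τs, τ1]; ring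
    by_cases hid : i = d
    · subst hid
      rw [τ3, map_neg, h3, map_add, map_mul, τ3, τs, hτ c (Ne.symm hbc) hcd]; ring
    by_cases hie : i = e
    · subst hie
      rw [hτ i (Ne.symm hbe) (Ne.symm hde), h4, map_add, map_mul, hτ i (Ne.symm hbe) (Ne.symm hde),
        τs, τ3]; ring
    · rw [hτ i hib hid, hσ i hib hic hid hie, hτ i hib hid]
  exact congrArg (fun φ : MvPolynomial (Option (Fin n)) k →ₐ[k] MvPolynomial (Option (Fin n)) k =>
    φ y) key

end Summit.ResolutionOfSingularities.ResolutionOfSingularities.Theorems.WildQuotientResolution.JordanFive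

end
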